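/-
Copyright (c) 2026 the pub-hodgecm-mathlib formalisation cell (harness21).  Prover seat hodgecm-mathlib-K2E3-p17 (g9), Track B «K2-LIT» / h413
(`stmt-HodgeConjecture-24833`), line `K2_E3_EllipticInputs`, leaf (nsc-S-A'), D120 brick IRR''-c2 «Kill», part (K-a): the `Fin 2` ↔ `Bool` relabelling of the Levi of
`P_{(2,1)}` and of its Jacquet module.  2026-09-04.
-/
import Summits.HodgeConjecture.HodgeConjecture.Theorems.K2E3ParabolicCharacterLeviUnipotentGL   -- ★ `exists_homeomorph_leviProjection_inclusion`
import Summits.HodgeConjecture.HodgeConjecture.Theorems.K2E3GL3KMUAbsContTransport              -- ★ `mem_standardLeviGL_fin2_iff_bool`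
import Summits.HodgeConjecture.HodgeConjecture.Theorems.K2E3GL3MaximalParabolicRelabel          -- ★ `unipotentRadicalGL_eq_bool`
import Summits.HodgeConjecture.HodgeConjecture.Theorems.K2E3GL2JacquetRelabel                   -- ★ `coinvariantsKer_restrictUnipotentGL_eq`
import Literature.NumberTheory.Automorphic.GLnTwoBlockLeviStructure                             -- ★ `mem_standardLeviGL_iff`
import Literature.NumberTheory.Automorphic.GLnCongruenceSubgroups                               -- ★ `mem_unipotentRadicalGL_iff_apply`
import Literature.NumberTheory.Automorphic.ParabolicInductionRefinementProofs                   -- ★ `cutUnipotent`, `mem_cutUnipotent_iff`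
import Literature.NumberTheory.Automorphic.ParabolicSemidirect                                  -- ★ `blockDiagonalGL_apply_coe_dite`
import HarnessLib

/-!
# Crux `H413` — leaf (nsc-S-A′), brick IRR″-c2 (K-a): THE `Fin 2 ↔ Bool` RELABELLING OF THE LEVI OF `Q = P_{(2,1)}` AND OF `r_Q`

Cell `hodgecm-mathlib`, Track B; THEOREMS ONLY; count-neutral helper (`--supports stmt-HodgeConjecture-24833 --as helper`).  The structural bricks of the leaf (★ BRIDGE, ★ STD-EMB,
★ IRR″-c1 `exists_peel_tower`, ★ S3) label the maximal parabolic `Q` by `![false, false, true] : Fin 3 → Bool`, whereas the cell binder `h3cell` (★ E4a, ★ (CELL-3)) and ★ LIFT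
(`K2E3JacquetSubquotientNoCuspidal`) label it by `![0, 0, 1] : Fin 3 → Fin 2`.  The two parabolics, unipotent radicals and Levis are the same subgroups of `GL₃(F)`
(★ `unipotentRadicalGL_eq_bool`, ★ `mem_standardLeviGL_fin2_iff_bool`); this file packages the identification at the level of the block-family Levi quotients:
* §1 **`exists_leviRelabel`** — an isomorphism of topological groups `φ : (Π a, GL {i // ![0,0,1] i = a} F) ≃ₜ* (Π a, GL {i // ![f,f,t] i = a} F)` with
  `blockDiagonalGL F ![f,f,t] (φ m) = blockDiagonalGL F ![0,0,1] m` (★ `exists_homeomorph_leviProjection_inclusion` on both sides of ★ `mem_standardLeviGL_fin2_iff_bool`, ★ `leviProjection_leviEmbeddingP_apply`);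
* §2 **`exists_jacquetRelabel`** — a linear isomorphism `Θ : r_Q^{Bool} ρ ≃ r_Q^{Fin} ρ` with `Θ [v] = [v]` (the two kernels coincide, ★ `coinvariantsKer_restrictUnipotentGL_eq`),
  and **`jacquetRelabel_jacquetGL`** — `Θ` intertwines `jacquetGL F ![f,f,t] ρ (φ m)` with `jacquetGL F ![0,0,1] ρ m` for any `φ` as in §1;
* §3 **`mem_cutUnipotent_of_blockDiagonalGL_mem`** — a Levi element whose block-diagonal matrix lies in the unipotent radical of the BOREL is a cut unipotent for the cut `(0 | 1)`
  (`cutUnipotent F ![0,0,1] 0`, the hypothesis shape of ★ `isSupercuspidal_of_forall_cut` ∕ ★ `eq_zero_of_forall_cut_cyclic`).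
Consumers: (K-b) `K2E3JacquetSubquotientNoCuspidalBool`, (K-c) `K2E3GL3OneLinkNestedHighKill`.

HONEST LABEL: HC_CM is proved only modulo the 7 printed citations (2 remaining named inputs: hLiu418 = stmt-HodgeConjecture-24832, h413 =
stmt-HodgeConjecture-24833) until rung 0 closes; count-neutral helper.

## References
* [BernsteinZelevinsky1977] I. N. Bernstein, A. V. Zelevinsky, *Induced representations of reductive p-adic groups I*, Ann. Sci. ÉNS 10 (1977), §2.1, §2.3.
-/

set_option autoImplicit false
-- the mandated namespace repeats `HodgeConjecture.HodgeConjecture`, as in every `Theorems/*.lean` of this sub-problem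
set_option linter.dupNamespace false

noncomputable section

open Representation Literature.NumberTheory.Automorphic Literature.NumberTheory.GaloisRepresentations.IsNonarchimedeanLocalField
open scoped MatrixGroups

namespace Summit.HodgeConjecture.HodgeConjecture.Cruxes.H413.K2E3GL3JacquetLeviRelabel

variable (F : Type) [Field F] [ValuativeRel F] [TopologicalSpace F] [IsNonarchimedeanLocalField F]

/-! ## §1 The relabelling isomorphism of the Levi quotients -/

/-- **`Fin 2 ↔ Bool` RELABELLING OF THE LEVI OF `P_{(2,1)}`**: an isomorphism of topological groups between the block families of the two labellings with the same block-diagonal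
matrices in `GL₃(F)`. [cite: BernsteinZelevinsky1977, §2.1] -/
theorem exists_leviRelabel :
    ∃ φ : (Π a, GL {i // (![0, 0, 1] : Fin 3 → Fin 2) i = a} F) ≃ₜ* (Π a, GL {i // (![false, false, true] : Fin 3 → Bool) i = a} F),
      ∀ m, blockDiagonalGL F (![false, false, true] : Fin 3 → Bool) (φ m) = blockDiagonalGL F (![0, 0, 1] : Fin 3 → Fin 2) m := by
  haveI : IsTopologicalRing F := inferInstance
  obtain ⟨hF, hhF⟩ := K2E3ParabolicCharacterLeviUnipotentGL.exists_homeomorph_leviProjection_inclusion F (![0, 0, 1] : Fin 3 → Fin 2)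
  obtain ⟨hB, hhB⟩ := K2E3ParabolicCharacterLeviUnipotentGL.exists_homeomorph_leviProjection_inclusion F (![false, false, true] : Fin 3 → Bool)
  have hM : standardLeviGL F (![0, 0, 1] : Fin 3 → Fin 2) = standardLeviGL F (![false, false, true] : Fin 3 → Bool) :=
    Subgroup.ext fun g => (K2E3GL3KMUAbsContTransport.mem_standardLeviGL_fin2_iff_bool (F := F) g).1
  -- the three pieces as isomorphisms of topological groups
  let ηF : ↥(standardLeviGL F (![0, 0, 1] : Fin 3 → Fin 2)) ≃ₜ* (Π a, GL {i // (![0, 0, 1] : Fin 3 → Fin 2) i = a} F) :=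
    { toEquiv := hF.toEquiv
      map_mul' := fun x y => by
        change hF (x * y) = hF x * hF y
        rw [hhF, hhF, hhF, map_mul, map_mul]
      continuous_toFun := hF.continuous
      continuous_invFun := hF.symm.continuous }
  let ηB : ↥(standardLeviGL F (![false, false, true] : Fin 3 → Bool)) ≃ₜ* (Π a, GL {i // (![false, false, true] : Fin 3 → Bool) i = a} F) :=
    { toEquiv := hB.toEquiv
      map_mul' := fun x y => by
        change hB (x * y) = hB x * hB y
        rw [hhB, hhB, hhB, map_mul, map_mul]
      continuous_toFun := hB.continuous
      continuous_invFun := hB.symm.continuous }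
  let ι : ↥(standardLeviGL F (![0, 0, 1] : Fin 3 → Fin 2)) ≃ₜ* ↥(standardLeviGL F (![false, false, true] : Fin 3 → Bool)) :=
    { MulEquiv.subgroupCongr hM with
      continuous_toFun := Continuous.subtype_mk continuous_subtype_val _
      continuous_invFun := Continuous.subtype_mk continuous_subtype_val _ }
  have hι : ∀ m, ((ι m : ↥(standardLeviGL F (![false, false, true] : Fin 3 → Bool))) : GL (Fin 3) F) = (m : GL (Fin 3) F) := fun _ => rfl
  refine ⟨(ηF.symm.trans ι).trans ηB, fun m => ?_⟩
  -- `blockDiagonalGL (proj (incl l)) = l` on both sides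
  have h1 : ∀ l : ↥(standardLeviGL F (![false, false, true] : Fin 3 → Bool)), blockDiagonalGL F (![false, false, true] : Fin 3 → Bool) (ηB l) = (l : GL (Fin 3) F) := by
    intro l
    obtain ⟨x, hx⟩ := l.2
    have hincl : Subgroup.inclusion (standardLeviGL_le F (![false, false, true] : Fin 3 → Bool)) l = leviEmbeddingP F _ x :=
      Subtype.ext (by rw [Subgroup.coe_inclusion, coe_leviEmbeddingP, ← leviEmbedding_apply, hx])
    change blockDiagonalGL F _ (hB l) = _
    rw [hhB, hincl, leviProjection_leviEmbeddingP_apply, ← leviEmbedding_apply, hx]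
  have h2 : ∀ l : ↥(standardLeviGL F (![0, 0, 1] : Fin 3 → Fin 2)), blockDiagonalGL F (![0, 0, 1] : Fin 3 → Fin 2) (ηF l) = (l : GL (Fin 3) F) := by
    intro l
    obtain ⟨x, hx⟩ := l.2
    have hincl : Subgroup.inclusion (standardLeviGL_le F (![0, 0, 1] : Fin 3 → Fin 2)) l = leviEmbeddingP F _ x :=
      Subtype.ext (by rw [Subgroup.coe_inclusion, coe_leviEmbeddingP, ← leviEmbedding_apply, hx])
    change blockDiagonalGL F _ (hF l) = _
    rw [hhF, hincl, leviProjection_leviEmbeddingP_apply, ← leviEmbedding_apply, hx]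
  have h3 : ηF (ηF.symm m) = m := ηF.apply_symm_apply m
  change blockDiagonalGL F _ (ηB (ι (ηF.symm m))) = _
  rw [h1, hι, ← h2 (ηF.symm m), h3]

/-! ## §2 The relabelling of the Jacquet module -/

variable {F}
variable {X : Type*} [AddCommGroup X] [Module ℂ X] (ρ : Representation ℂ (GL (Fin 3) F) X)

omit [ValuativeRel F] [TopologicalSpace F] [IsNonarchimedeanLocalField F] in
/-- The two Jacquet kernels `V(U_Q)` coincide (`U_{![f,f,t]} = U_{![0,0,1]}`). [cite: BernsteinZelevinsky1977, §2.3] -/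
theorem coinvariantsKer_bool_eq_fin :
    Coinvariants.ker (restrictUnipotentGL F (![false, false, true] : Fin 3 → Bool) ρ) = Coinvariants.ker (restrictUnipotentGL F (![0, 0, 1] : Fin 3 → Fin 2) ρ) :=
  K2E3GL2JacquetRelabel.coinvariantsKer_restrictUnipotentGL_eq _ _ (K2E3GL3MaximalParabolicRelabel.unipotentRadicalGL_eq_bool (F := F)).symm ρ

omit [ValuativeRel F] [TopologicalSpace F] [IsNonarchimedeanLocalField F] in
/-- **`Θ : r_Q^{Bool} ρ ≃ r_Q^{Fin} ρ`, `Θ [v] = [v]`.** [cite: BernsteinZelevinsky1977, §2.3] -/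
theorem exists_jacquetRelabel :
    ∃ Θ : (restrictUnipotentGL F (![false, false, true] : Fin 3 → Bool) ρ).Coinvariants ≃ₗ[ℂ] (restrictUnipotentGL F (![0, 0, 1] : Fin 3 → Fin 2) ρ).Coinvariants,
      ∀ v, Θ (Coinvariants.mk (restrictUnipotentGL F (![false, false, true] : Fin 3 → Bool) ρ) v) = Coinvariants.mk (restrictUnipotentGL F (![0, 0, 1] : Fin 3 → Fin 2) ρ) v :=
  ⟨Submodule.quotEquivOfEq _ _ (coinvariantsKer_bool_eq_fin ρ), fun _ => rfl⟩

omit [ValuativeRel F] [IsNonarchimedeanLocalField F] in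
/-- **`Θ` INTERTWINES THE TWO LEVI ACTIONS**: `Θ (r_Q^{Bool} ρ (φ m) x) = r_Q^{Fin} ρ m (Θ x)` for any relabelling `φ` with the same block-diagonal matrices.
[cite: BernsteinZelevinsky1977, §2.3] -/
theorem jacquetRelabel_jacquetGL
    (φ : (Π a, GL {i // (![0, 0, 1] : Fin 3 → Fin 2) i = a} F) ≃ₜ* (Π a, GL {i // (![false, false, true] : Fin 3 → Bool) i = a} F))
    (hφ : ∀ m, blockDiagonalGL F (![false, false, true] : Fin 3 → Bool) (φ m) = blockDiagonalGL F (![0, 0, 1] : Fin 3 → Fin 2) m)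
    (Θ : (restrictUnipotentGL F (![false, false, true] : Fin 3 → Bool) ρ).Coinvariants ≃ₗ[ℂ] (restrictUnipotentGL F (![0, 0, 1] : Fin 3 → Fin 2) ρ).Coinvariants)
    (hΘ : ∀ v, Θ (Coinvariants.mk (restrictUnipotentGL F (![false, false, true] : Fin 3 → Bool) ρ) v) = Coinvariants.mk (restrictUnipotentGL F (![0, 0, 1] : Fin 3 → Fin 2) ρ) v)
    (m : Π a, GL {i // (![0, 0, 1] : Fin 3 → Fin 2) i = a} F) (x : (restrictUnipotentGL F (![false, false, true] : Fin 3 → Bool) ρ).Coinvariants) :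
    Θ (jacquetGL F (![false, false, true] : Fin 3 → Bool) ρ (φ m) x) = jacquetGL F (![0, 0, 1] : Fin 3 → Fin 2) ρ m (Θ x) := by
  obtain ⟨v, rfl⟩ := Coinvariants.mk_surjective _ x
  rw [jacquetGL_mk, hΘ, hΘ, jacquetGL_mk, hφ]

/-! ## §3 Levi elements with Borel-unipotent matrix are cut unipotents -/

omit [ValuativeRel F] [TopologicalSpace F] [IsNonarchimedeanLocalField F] in
/-- **A Levi element `m` of `P_{(2,1)}` whose block-diagonal matrix lies in the unipotent radical `U_B` of the Borel is a cut unipotent for the cut `(0 | 1)` of the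
`GL₂`-block** (`m 1 = 1` and `m 0` is upper unitriangular). [cite: BernsteinZelevinsky1977, §2.1–2.2] -/
theorem mem_cutUnipotent_of_blockDiagonalGL_mem (m : Π a, GL {i // (![0, 0, 1] : Fin 3 → Fin 2) i = a} F)
    (hm : blockDiagonalGL F (![0, 0, 1] : Fin 3 → Fin 2) m ∈ unipotentRadicalGL F (id : Fin 3 → Fin 3)) :
    m ∈ cutUnipotent F (![0, 0, 1] : Fin 3 → Fin 2) 0 := by
  have hent := (mem_unipotentRadicalGL_iff_apply (c := (id : Fin 3 → Fin 3)) _).1 hm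
  -- entries of the blocks are entries of the block-diagonal matrix
  have hblk : ∀ (a : Fin 2) (i j : {k : Fin 3 // (![0, 0, 1] : Fin 3 → Fin 2) k = a}),
      ((m a : GL {k : Fin 3 // (![0, 0, 1] : Fin 3 → Fin 2) k = a} F) : Matrix _ _ F) i j =
        ((blockDiagonalGL F (![0, 0, 1] : Fin 3 → Fin 2) m : GL (Fin 3) F) : Matrix (Fin 3) (Fin 3) F) (i : Fin 3) (j : Fin 3) := by
    rintro a ⟨i, rfl⟩ ⟨j, hj⟩
    rw [blockDiagonalGL_apply_coe_dite, dif_pos hj.symm]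
  have hone : ∀ (i : Fin 3), (![0, 0, 1] : Fin 3 → Fin 2) i = 1 → i = 2 := by decide
  have hkey : ∀ (i j : Fin 3) (hi : (![0, 0, 1] : Fin 3 → Fin 2) i = 0) (hj : (![0, 0, 1] : Fin 3 → Fin 2) j = 0),
      cutLabel (![0, 0, 1] : Fin 3 → Fin 2) 0 ⟨j, hj⟩ ≤ cutLabel (![0, 0, 1] : Fin 3 → Fin 2) 0 ⟨i, hi⟩ → (id : Fin 3 → Fin 3) j ≤ (id : Fin 3 → Fin 3) i := by
    decide
  refine (mem_cutUnipotent_iff (R := F)).2 ⟨fun a ha => ?_, ?_⟩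
  · -- the block `a = 1` is the identity
    have ha1 : a = 1 := by
      fin_cases a
      · exact absurd rfl ha
      · rfl
    subst ha1
    ext i j
    rw [hblk, Units.val_one]
    obtain ⟨i, hi⟩ := i
    obtain ⟨j, hj⟩ := j
    obtain rfl := hone i hi
    obtain rfl := hone j hj
    rw [hent 2 2 le_rfl, Matrix.one_apply_eq, Matrix.one_apply_eq]
  · -- the block `a = 0` is upper unitriangular
    refine (mem_unipotentRadicalGL_iff_apply (c := cutLabel (![0, 0, 1] : Fin 3 → Fin 2) 0) _).2 fun i j hij => ?_
    rw [hblk]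
    obtain ⟨i, hi⟩ := i
    obtain ⟨j, hj⟩ := j
    rw [hent i j (hkey i j hi hj hij)]
    by_cases h : i = j
    · subst h
      rw [Matrix.one_apply_eq, Matrix.one_apply_eq]
    · rw [Matrix.one_apply_ne h, Matrix.one_apply_ne (fun e => h (congrArg Subtype.val e))]

end Summit.HodgeConjecture.HodgeConjecture.Cruxes.H413.K2E3GL3JacquetLeviRelabel

end
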